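import Summits.RiemannHypothesis.Statement
import Literature.NumberTheory.LFunctions.SuzukiWeilHilbertSpaceDefs
import HarnessLib
import HarnessLib.Audit

/-!
# RiemannHypothesis / COLUMN 6 (DBR) — the C2 isolation: residual `IsolatedV0` and rung leaf `ChainDoorV0`

LINE 1 — LABELS: `IsolatedV0` is the DECLARED RESIDUAL, RH-EQUIVALENT·PRINTED both ways (M. Suzuki,
*On the Hilbert space derived from the Weil distribution*, Canad. J. Math. (2025) = arXiv:2301.00421,
Thm. 1.3, p. 3 L75–90: "the RH is true if and only if the following two conditions hold"); it is
nobody's proving target. `ChainDoorV0 := IsolatedV0 → RiemannHypothesis` is the RH-FREE door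
(Thm. 1.3 ⟸, printed proof §3.4 p. 7 L129–149, an 8-line Weil-sign argument), the rung leaf B-P of
the cell rh-crit/dbl (reserved route «DeBrangesChain», D-0059/D-0061). bears_on: B-C/B-P (LADDER-RH §1
COLUMN 6 DBR). WHAT THIS IS NOT: not a proof plan for RH; formalising this criterion fixes WHICH
identity on Suzuki's RH-free space `V(0) = L²(0,∞) ∩ 𝖪L²(0,∞)` would prove RH through this door —
it does not move RH; the door is the CHEAP direction of the printed equivalence (the deep content,
RH ⟹ IsolatedV0, is Suzuki's Thm. 1.2 structure theorem, an RH-CONSEQUENCE typed elsewhere in the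
cell). Nothing here bears on the truth of RH.

Statement-only module (`@[conjecture]` Props over the Literature objects of
`Literature/NumberTheory/LFunctions/SuzukiWeilHilbertSpaceDefs.lean`; no `sorry`, no axioms). The
door's proof is the sibling `Theorems/DeBrangesChainDoor.lean` (`chainDoorV0_proof`), whose RH-FREE
inputs are: additivity of the evaluation `HasHatValue` in `ψ` (from `𝖪` additive, by construction),
the conjugation symmetry `ρ ↦ 1 − ρ̄` of the non-trivial zeros with `γ(1 − ρ̄) = conj γ(ρ)`, the tree
summability `Σ_ρ m(ρ)/(1 + (Im ρ)²) < ∞` (`ZetaZeroSum.summable_zeroOrder_div_one_add_sq`), and a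
pure-analysis sign lemma ("negativity under separation"). The converse RH ⟹ `IsolatedV0` is NOT
claimed here (RH-CONSEQUENCE: [Su25c] Thm. 1.2 (1)(2) + the orthogonal basis `ψ_γ` of `V(0)`, p. 6).

Conjunct analysis (cell dbl/RESIDUAL.md v1 §1.5): each of the two conjuncts alone is an
RH-CONSEQUENCE whose converse is not in print; the second implies `V(0) ≠ {0}`, which Suzuki leaves
OPEN unconditionally (p. 3 L41–44: "it is interesting to prove or disprove `V(0) ≠ {0}`
unconditionally, but we leave it as a future task"; `V(0) = {0}` would refute RH). Hence ONE residual
decl (director-rh 2026-08-26T01:24:56Z), never split.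
-/

noncomputable section

-- D-0017: `Summit.<S>.<S>.…` is the designed namespace of a single-problem summit.
set_option linter.dupNamespace false

namespace Summit.RiemannHypothesis.RiemannHypothesis.Theorems.DeBrangesChain

open Literature.NumberTheory.LFunctions

/-- **DECLARED RESIDUAL `IsolatedV0` — RH-EQUIVALENT·PRINTED (l.1): [Su25c] Thm. 1.3 conditions
(1) ∧ (2) on Suzuki's space `V(0) = L²(0,∞) ∩ 𝖪L²(0,∞)`** (refutation budget only; never a proving
target; never a binder of a `closes`). (1) `WeilNormIdentityOn (suzukiV 0)`: for every `ψ ∈ V(0)`,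
`‖ψ‖²_{L²(ℝ)} = ½⟨ψ,ψ⟩_W = ½ Σ_{γ∈Γ} m_γ ψ̂(γ) conj ψ̂(γ̄)`; (2) `ZeroSeparationOn (suzukiV 0)`:
`∃ δ > 0, ∀ γ ∈ Γ, ∀ ε > 0, ∃ ψ ∈ V(0)` with `ψ̂(γ) = 1` and `|ψ̂(γ′)| ≤ ε|γ − γ′|^{−1−δ}` for
`γ′ ∈ Γ ∖ {γ}` (quantifier order AS PRINTED, "δ independent of γ, ε, ψ"). Directions: RH ⟹
`IsolatedV0` is Suzuki's Thm. 1.2 (RH-CONSEQUENCE, not claimed in the tree); `IsolatedV0` ⟹ RH is the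
RH-FREE door `ChainDoorV0` below. Different object and different residual from rh-dbr's
`DoorWitness` (stmt 19728) / `AllWindowsWitness` (19733) (shift family `E^{ω,ν}`, single kernel `K_θ`):
here the DERIVATIVE structure function `E_ξ = ξ + ξ′` of Lagarias 2006 and Suzuki's chain `V(t)`.
[cite: Suzuki2025WeilHilbertSpace, Thm. 1.3, p. 3] -/
@[conjecture] def IsolatedV0 : Prop :=
  WeilNormIdentityOn (suzukiV 0) ∧ ZeroSeparationOn (suzukiV 0)

/-- **THE RUNG LEAF `ChainDoorV0` — RH-FREE door theorem, hypothesis-free form (l.1):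
`IsolatedV0 → RiemannHypothesis`** ([Su25c] Thm. 1.3 ⟸; printed proof §3.4 p. 7 L129–149: at a
non-real `γ₀ ∈ Γ` condition (2) gives `ψ₁, ψ₂ ∈ V(0)` with `ψ̂₁(γ₀) = 1`, `ψ̂₂(γ̄₀) = 1` and
`ε|γ₀ − ·|^{−1−δ}`-small values elsewhere; for `ψ = ψ₁ − ψ₂` the Weil sum `Σ m_γ ψ̂(γ) conj ψ̂(γ̄)`
has real part `≤ −(m_{γ₀} + m_{γ̄₀})/4 + O(ε²) < 0`, contradicting (1) which makes it `2‖ψ‖² ≥ 0`).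
PROVED in `Theorems/DeBrangesChainDoor.lean` (`chainDoorV0_proof`). An RH-FREE theorem ABOUT an
RH-EQUIVALENT criterion; proving it is transcription-grade work, not progress on RH.
[cite: Suzuki2025WeilHilbertSpace, Thm. 1.3 (proof of sufficiency, §3.4), p. 7] -/
@[conjecture] def ChainDoorV0 : Prop :=
  IsolatedV0 → _root_.RiemannHypothesis

/-- Pure-logic glue (PROVED): the leaf and the residual together give the summit statement — recorded
only to make the conjunct split `X = ChainDoorV0 ∧ IsolatedV0` explicit (`ChainDoorV0` the RH-FREE
conjunct attacked, `IsolatedV0` the named RH-EQUIVALENT residual). [folklore] -/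
theorem riemannHypothesis_of_chainDoorV0_of_isolatedV0 (hD : ChainDoorV0) (hI : IsolatedV0) :
    Summit.RiemannHypothesis :=
  hD hI

end Summit.RiemannHypothesis.RiemannHypothesis.Theorems.DeBrangesChain

end
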